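import Mathlib.CategoryTheory.Quotient
import Mathlib.CategoryTheory.Comma.Over.Basic
import Mathlib.GroupTheory.Index
import Mathlib.GroupTheory.OrderOfElement
import Mathlib.GroupTheory.QuotientGroup.Basic
import Mathlib.CategoryTheory.SingleObj
import Mathlib.CategoryTheory.Galois.Basic
import Literature.AlgebraicGeometry.Frobenioids.CategoriesFactorization
import Literature.AlgebraicGeometry.Frobenioids.ElementaryFrobenioid
import Literature.AlgebraicGeometry.Frobenioids.PreFrobenioidData
import HarnessLib

/-!
# Frobenioids I, §3 "Category-theoreticity of the base and Frobenius degree": Definition 3.1,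
# Remarks 3.1.1–3.1.3, Propositions 3.2 and 3.3

Mochizuki, *The geometry of Frobenioids I: the general theory*, Kyushu J. Math. **62** (2008)
293–400, kurims text pp. 56–61 [cite: MochizukiFrdI2008, §3 pp.56-61]. Standing data of §3 (p. 56):
a divisorial monoid `Φ` on a connected, totally epimorphic category `D` and a Frobenioid `C → F_Φ`;
here `S : PreFrobenioidData C D` are its operations (file `PreFrobenioidData.lean`, INTERFACE,
`TODO-merge: abc-iut-found`); the standing hypothesis "`C` is a Frobenioid" (Def. 1.3, owned by the
cell's Def. 1.1–1.3 files) is NOT restated: every numbered claim below is typed as a *conclusion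
predicate* `… (S) … : Prop` which the paper asserts for all Frobenioids, and the corresponding named
fact is the 3-line wrapper `∀ Frobenioids, …` once `Frobenioid` lands (STATEMENTS-FIRST, D-0014).

Contents, one declaration per printed sub-item:
* for the standard Frobenioid `𝔽 = F_{ℤ_{≥0}}` (`StandardFrobenioid` of `ElementaryFrobenioid.lean`): its
  surjection `degHom` to `N_{≥1}`, the section `degSection`, the generator `gen` and their relations
  (needed by "Frobenius-slim" and Rem. 3.1.2);
* Def. 3.1 (i) quasi-isotropic type, standard type (a)–(e), Frobenius-slim categories, with
  "every slim category is Frobenius-slim" PROVED (`IsSlim.isFrobeniusSlim`);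
* Def. 3.1 (ii)–(iii) `C^pf`: the perfection needs the transition maps "`φ ↦ φ'`" of Prop. 1.10 (i)
  (seat abc-iut-L1-t1), so it is recorded as an INTERFACE `PerfectionData` (the functor `C → C^pf`
  with the object description `(A, n)`), over which Prop. 3.2 is typed;
* Def. 3.1 (iv) unit-equivalence `≈^{O^×}` (DEFINED) and the unit-trivialisation `C^un-tr` (DEFINED as
  the quotient category of `C^istr` by the congruence generated by `≈^{O^×}` — Prop. 3.3 (ii) says the
  relation is already a congruence — with the functor `C^istr → C^un-tr`);
* Rem. 3.1.1 (typed; its bracketed consequence PROVED from it), Rem. 3.1.2 (PROVED: a homomorphism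
  from `𝔽` to a residually finite group factors through `𝔽 ↠ N_{≥1}`; hence the Frobenius-slimness
  criterion), Rem. 3.1.3 (the dichotomy is prose; its checkable examples "`N_{≥1}` as a one-object
  category / `Order(ℤ_{≥0})` are not of FSMFF-type" are typed as a claim);
* Prop. 3.2 (i)–(iii) and Prop. 3.3 (i)–(v) typed ((iii) "full and essentially surjective" PROVED for
  the quotient construction). v5 (referee PASS-C2/C3): the divisor component of Prop. 3.2 (i)'s square is
  `Prop32i_div` (over the map `Φ → Φ^pf` as a parameter); the three classes of Prop. 3.2 (ii) missing from
  `Prop32ii` are `Prop32ii_rest`; the binder of `EndPlbkBsIso.naturality` is justified by the PROVED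
  two-out-of-three `IsPullbackMorphism.of_comp`. Tracking (C2-Ff): of Prop. 3.3 (iv), the clauses "the
  induced `C^un-tr → F_Φ` is a Frobenioid structure of isotropic, unit-trivial type" and "an arrow of
  `C^un-tr` is [one of nine classes] iff it arises from such an arrow of `C^istr`" are not typed in operations
  form here (they need the operations `(Base, Div, deg_Fr)` of `C^un-tr`, not constructed in the tree).
No statement of the paper is strengthened; nothing here is specific to the abc programme.
-/

namespace Literature.AlgebraicGeometry.Frobenioids

open CategoryTheory

universe w v v' u u'

/-! ### The standard Frobenioid `𝔽` (Def. 1.1 (iii)): degree map, section and generator -/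

namespace StandardFrobenioid

/-- The natural surjection `𝔽 ↠ N_{≥1}`, `(a, n) ↦ n`, of the standard Frobenioid
`𝔽 = F_{ℤ_{≥0}}` of `ElementaryFrobenioid.lean` (FrdI Def. 1.1 (iii) p. 20; used in Def. 3.1 (i) p. 56).
[cite: MochizukiFrdI2008, Def. 3.1 (i) p.56] -/
def degHom : StandardFrobenioid →* ℕ+ where
  toFun x := x.degFr
  map_one' := rfl
  map_mul' _ _ := rfl

/-- `𝔽 → N_{≥1}` is surjective (split by `n ↦ (0, n)`). [cite: MochizukiFrdI2008, Def. 1.1 (iii) p.20] -/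
theorem degHom_surjective : Function.Surjective degHom := fun n => ⟨⟨1, n⟩, rfl⟩

/-- The section `n ↦ (0, n)` of `𝔽 ↠ N_{≥1}` is a homomorphism. [cite: MochizukiFrdI2008, Def. 1.1 (iii) p.20] -/
def degSection : ℕ+ →* StandardFrobenioid where
  toFun n := ⟨1, n⟩
  map_one' := rfl
  map_mul' _ _ := by ext <;> simp

/-- The generator `γ = (1, 1)` of the `ℤ_{≥0}`-part (the image of `1 ∈ ℤ_{≥0} ⊆ 𝔽`, Rem. 3.1.2 p. 58).
[cite: MochizukiFrdI2008, Rem. 3.1.2 p.58] -/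
def gen : StandardFrobenioid := ⟨Multiplicative.ofAdd 1, 1⟩

/-- Powers of the generator: `γ^a = (a, 1)`. [cite: MochizukiFrdI2008, Rem. 3.1.2 p.58] -/
theorem gen_pow (a : ℕ) : gen ^ a = ⟨Multiplicative.ofAdd a, 1⟩ := by
  induction a with
  | zero => rfl
  | succ a ih =>
    rw [pow_succ, ih]
    ext
    · show Multiplicative.ofAdd (a : ℕ) * (Multiplicative.ofAdd 1) ^ ((1 : ℕ+) : ℕ) = Multiplicative.ofAdd (a + 1)
      rw [PNat.one_coe, pow_one, ← ofAdd_add]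
    · rfl

/-- The relation `δ_d · γ = γ^d · δ_d` with `δ_d = (0, d)` ("`δ_d γ δ_d^{-1} = γ^d`", Rem. 3.1.2 p. 58).
[cite: MochizukiFrdI2008, Rem. 3.1.2 p.58] -/
theorem degSection_mul_gen (d : ℕ+) : degSection d * gen = gen ^ (d : ℕ) * degSection d := by
  rw [gen_pow]
  ext
  · show 1 * (Multiplicative.ofAdd 1) ^ (d : ℕ) = Multiplicative.ofAdd (d : ℕ) * 1 ^ ((1 : ℕ+) : ℕ)
    rw [one_mul, one_pow, mul_one, ← ofAdd_nsmul, smul_eq_mul, mul_one]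
  · show d * 1 = 1 * d
    rw [mul_one, one_mul]

/-- Every element factors as `(a, n) = γ^a · δ_n`. [cite: MochizukiFrdI2008, Rem. 3.1.2 p.58] -/
theorem eq_gen_pow_mul_degSection (x : StandardFrobenioid) :
    x = gen ^ (Multiplicative.toAdd x.div) * degSection x.degFr := by
  rw [gen_pow]
  ext
  · show x.div = Multiplicative.ofAdd (Multiplicative.toAdd x.div) * 1 ^ ((1 : ℕ+) : ℕ)
    rw [ofAdd_toAdd, one_pow, mul_one]
  · show x.degFr = 1 * x.degFr
    rw [one_mul]

/-- The units of `𝔽` are trivial: `x · y = 1` forces `x = 1`. [cite: MochizukiFrdI2008, Def. 1.1 (iii) p.20] -/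
theorem eq_one_of_mul_eq_one {x y : StandardFrobenioid} (h : x * y = 1) : x = 1 := by
  have h2 : x.degFr * y.degFr = 1 := by rw [← ElemFrobenioidMonoid.mul_degFr, h]; rfl
  have h1 : x.div * y.div ^ (x.degFr : ℕ) = 1 := by rw [← ElemFrobenioidMonoid.mul_div, h]; rfl
  have h3 : (x.degFr : ℕ) * (y.degFr : ℕ) = 1 := by
    have := congrArg PNat.val h2
    rwa [PNat.mul_coe] at this
  have h4 : Multiplicative.toAdd x.div + (x.degFr : ℕ) * Multiplicative.toAdd y.div = 0 := by
    have := congrArg Multiplicative.toAdd h1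
    rwa [toAdd_mul, toAdd_pow, toAdd_one, smul_eq_mul] at this
  ext
  · show x.div = Multiplicative.ofAdd 0
    rw [← ofAdd_toAdd x.div]
    congr 1
    omega
  · show x.degFr = (1 : ℕ+)
    exact PNat.coe_injective ((Nat.eq_one_of_mul_eq_one_right h3).trans PNat.one_coe.symm)

end StandardFrobenioid

/-! ### Definition 3.1 (i): quasi-isotropic, standard, Frobenius-slim -/

section Def31

variable {C : Type u} [Category.{v} C] {D : Type u'} [Category.{v'} D]
variable (S : PreFrobenioidData.{w} C D)

namespace PreFrobenioidData

/-- `C` is *of quasi-isotropic type*: an object is non-isotropic iff it is an iso-subanchor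
(FrdI Def. 3.1 (i) p. 56). [cite: MochizukiFrdI2008, Def. 3.1 (i) p.56] -/
@[mk_iff] structure IsOfQuasiIsotropicType : Prop where
  /-- non-isotropic ⟺ iso-subanchor -/
  nonIsotropic_iff : ∀ A : C, ¬ S.IsIsotropic A ↔ IsIsoSubanchor A

/-- `C` is *of standard type*: (a) quasi-isotropic and Frobenius-isotropic type; (b) if of group-like
type then `C^istr` admits a Frobenius-compact object (Frobenius-compactness only involves `Aut_C(A)` and
`O^×(A)`, which `C^istr ⊆ C` computes as `C` does); (c) Frobenius-normalized type; (d) `D` of FSMFF-type;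
(e) `Φ` non-dilating (FrdI Def. 3.1 (i) p. 56). [cite: MochizukiFrdI2008, Def. 3.1 (i) p.56] -/
@[mk_iff] structure IsOfStandardType : Prop where
  /-- (a) -/
  quasiIsotropic : S.IsOfQuasiIsotropicType
  /-- (a) -/
  frobeniusIsotropic : S.IsOfFrobeniusIsotropicType
  /-- (b) -/
  frobeniusCompact_of_groupLike : S.IsOfGroupLikeType → ∃ A : C, S.IsIsotropic A ∧ S.IsFrobeniusCompact A
  /-- (c) -/
  frobeniusNormalized : S.IsOfFrobeniusNormalizedType
  /-- (d) -/
  fsmff : IsOfFSMFFType D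
  /-- (e) -/
  nonDilating : S.IsNonDilatingOn

end PreFrobenioidData

variable (C) in
/-- A category `E` is *Frobenius-slim* if every homomorphism of monoids `𝔽 → Aut(E_A → E)`,
`A ∈ Ob(E)`, factors through the natural surjection `𝔽 ↠ N_{≥1}` (FrdI Def. 3.1 (i) p. 56;
`Aut(E_A → E)` = automorphisms of the forgetful functor `Over A ⥤ E`). [cite: MochizukiFrdI2008, Def. 3.1 (i) p.56] -/
@[mk_iff] structure IsFrobeniusSlim : Prop where
  /-- every `𝔽 → Aut(E_A → E)` factors through `𝔽 ↠ N_{≥1}` -/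
  factors : ∀ (A : C) (f : StandardFrobenioid →* Aut (Over.forget A)),
    ∃ g : ℕ+ →* Aut (Over.forget A), f = g.comp StandardFrobenioid.degHom

/-- "[Thus, every slim category is Frobenius-slim.]" (FrdI Def. 3.1 (i) p. 56): a rigid functor has
trivial automorphism group. [cite: MochizukiFrdI2008, Def. 3.1 (i) p.56] -/
theorem IsSlim.isFrobeniusSlim (h : IsSlim C) : IsFrobeniusSlim C := by
  refine ⟨fun A f => ⟨1, MonoidHom.ext fun x => ?_⟩⟩
  rw [MonoidHom.comp_apply, MonoidHom.one_apply]
  exact h.isRigid_forget A (f x)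

end Def31

/-! ### Definition 3.1 (ii), (iii): the perfection `C^pf` (INTERFACE) -/

section Perfection

variable {C : Type u} [Category.{v} C] {D : Type u'} [Category.{v'} D]

/-- INTERFACE for the *perfection* `C^pf` of a Frobenioid of Frobenius-isotropic type (FrdI Def. 3.1
(ii)–(iii) pp. 56–57): its objects are the pairs `(A, n)`, `A ∈ Ob(C)`, `n ∈ N_{≥1}` ("an `n`-th root of
`A`"), `Hom((A, n), (B, m)) = Hom^pf_C(A', B')` for Frobenius-type arrows `A → A'`, `B → B'` of degrees
`m`, `n`, where the perfected morphisms `Hom^pf_C` are the inductive limit over `(A,B)C^bi-Fr` with the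
transition maps "`φ ↦ φ'`" of Prop. 1.10 (i); and the natural functor `C → C^pf`, `A ↦ (A, 1)`. The
transition maps are supplied by Prop. 1.10 (i) (seat abc-iut-L1-t1, `TODO-merge`), so the construction
is not repeated here: this structure records the resulting category, the functor and the object
description, over which Prop. 3.2 and Thm. 3.4 (iii) are typed. [cite: MochizukiFrdI2008, Def. 3.1 (iii) p.57] -/
structure PerfectionData (S : PreFrobenioidData.{w} C D) where
  /-- the category `C^pf` -/
  Pf : Type u
  [catPf : Category.{v} Pf]
  /-- the natural functor `C → C^pf`, `A ↦ (A, 1)` -/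
  toPf : C ⥤ Pf
  /-- the object `(A, n)` of `C^pf` -/
  root : C → ℕ+ → Pf
  /-- `(A, 1)` is the image of `A` -/
  root_one : ∀ A : C, root A 1 = toPf.obj A
  /-- every object of `C^pf` is some `(A, n)` -/
  root_surjective : ∀ X : Pf, ∃ (A : C) (n : ℕ+), root A n = X
  /-- the pre-Frobenioid structure `C^pf → F_{Φ^pf}` of Prop. 3.2 (i), as operations over `D` -/
  ops : PreFrobenioidData.{w} Pf D

/-- `C^pf` is a category (structure-carried instance, exposed). [cite: MochizukiFrdI2008, Def. 3.1 (iii) p.57] -/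
instance PerfectionData.instCategoryPf {S : PreFrobenioidData.{w} C D} (P : PerfectionData S) : Category P.Pf :=
  P.catPf

end Perfection

/-! ### Definition 3.1 (iv): unit-equivalence and the unit-trivialisation `C^un-tr` -/

section UnitTriv

variable {C : Type u} [Category.{v} C] {D : Type u'} [Category.{v'} D]
variable (S : PreFrobenioidData.{w} C D)

namespace PreFrobenioidData

/-- Two co-objective morphisms `α₁, α₂ : A → B` of `C^istr` are *unit-equivalent*, `α₁ ≈^{O^×} α₂`, if
`α₁ = β ∘ γ`, `α₂ = β ∘ δ ∘ γ` for some `γ : A → X`, `β : X → B` in `C^istr` and some `δ ∈ O^×(X)`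
(FrdI Def. 3.1 (iv) p. 57). [cite: MochizukiFrdI2008, Def. 3.1 (iv) p.57] -/
def UnitEquiv : HomRel S.Istr := fun A B α₁ α₂ =>
  ∃ (X : S.Istr) (γ : A ⟶ X) (β : X ⟶ B) (δ : Aut X.obj), δ ∈ S.unitsSubgroup X.obj ∧
    α₁ = γ ≫ β ∧ α₂ = γ ≫ ObjectProperty.homMk δ.hom ≫ β

/-- `≈^{O^×}` is reflexive (take `δ = 1`). [cite: MochizukiFrdI2008, Def. 3.1 (iv) p.57] -/
theorem UnitEquiv.refl {A B : S.Istr} (α : A ⟶ B) : S.UnitEquiv α α :=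
  ⟨A, 𝟙 A, α, 1, (S.unitsSubgroup A.obj).one_mem, (Category.id_comp α).symm, by
    rw [Category.id_comp]
    exact (Category.id_comp α).symm⟩

/-- "[Thus, if `C` is of unit-trivial type, then two co-objective morphisms of `C^istr` are
unit-equivalent if and only if they are equal.]" (FrdI Def. 3.1 (iv) p. 57).
[cite: MochizukiFrdI2008, Def. 3.1 (iv) p.57] -/
theorem unitEquiv_iff_eq_of_isUnitTrivialType (h : S.IsOfUnitTrivialType) {A B : S.Istr} (α₁ α₂ : A ⟶ B) :
    S.UnitEquiv α₁ α₂ ↔ α₁ = α₂ := by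
  refine ⟨?_, fun e => e ▸ UnitEquiv.refl S α₁⟩
  rintro ⟨X, γ, β, δ, hδ, rfl, rfl⟩
  have hδ1 : δ = 1 := by
    have := h.obj X.obj
    rw [PreFrobenioidData.IsUnitTrivial] at this
    rw [this] at hδ
    exact hδ
  subst hδ1
  congr 1
  have : (ObjectProperty.homMk (1 : Aut X.obj).hom : X ⟶ X) = 𝟙 X := rfl
  rw [this, Category.id_comp]

/-- The *unit-trivialisation* `C^un-tr`: objects those of `C^istr`, morphisms the unit-equivalence
classes `Hom^un-tr_{C^istr}(A, B)` (FrdI Def. 3.1 (iv) p. 57). DEFINED as the quotient category of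
`C^istr` by the congruence generated by `≈^{O^×}`; by Prop. 3.3 (ii) the relation is itself an
equivalence relation closed under composition, so no identification beyond the printed one occurs for a
Frobenioid. [cite: MochizukiFrdI2008, Def. 3.1 (iv) p.57] -/
abbrev Untr : Type u := CategoryTheory.Quotient S.UnitEquiv

/-- The natural functor `C^istr → C^un-tr` (FrdI Def. 3.1 (iv) p. 57, Prop. 3.3 (iii) p. 59).
[cite: MochizukiFrdI2008, Prop. 3.3 (iii) p.59] -/
abbrev toUntr : S.Istr ⥤ S.Untr := CategoryTheory.Quotient.functor S.UnitEquiv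

end PreFrobenioidData

end UnitTriv

/-! ### Remarks 3.1.1–3.1.3 -/

section Remarks

variable {C : Type u} [Category.{v} C] {D : Type u'} [Category.{v'} D]
variable (S : PreFrobenioidData.{w} C D)

/-- **Remark 3.1.1** (typed): "An iso-subanchor of the Frobenioid `C` is never isotropic" (FrdI p. 57;
the printed proof uses Prop. 1.10 (iv), Def. 1.3 (vii)(b), Prop. 1.9 (v), Def. 1.3 (v)(a)). Asserted for
every Frobenioid. [cite: MochizukiFrdI2008, Rem. 3.1.1 p.57] -/
def Remark311 : Prop := ∀ A : C, IsIsoSubanchor A → ¬ S.IsIsotropic A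

/-- "[In particular, if `C` is of isotropic type, then `C` is of quasi-isotropic type.]" — PROVED from the
observation of Remark 3.1.1 (FrdI p. 57). [cite: MochizukiFrdI2008, Rem. 3.1.1 p.57] -/
theorem PreFrobenioidData.IsOfIsotropicType.isOfQuasiIsotropicType (h : S.IsOfIsotropicType)
    (h311 : Remark311 S) : S.IsOfQuasiIsotropicType :=
  ⟨fun A => ⟨fun hA => (hA (h.obj A)).elim, fun hA _ => h311 A hA (h.obj A)⟩⟩

/-- A group is *residually finite*: the normal subgroups of finite index have trivial intersection,
i.e. every `g ≠ 1` lies outside some normal subgroup of finite index (FrdI Rem. 3.1.2 p. 58).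
[cite: MochizukiFrdI2008, Rem. 3.1.2 p.58] -/
def IsResiduallyFiniteGroup (G : Type*) [Group G] : Prop :=
  ∀ g : G, g ≠ 1 → ∃ N : Subgroup G, N.Normal ∧ N.FiniteIndex ∧ g ∉ N

/-- The key step of Remark 3.1.2: in a finite group, `δ γ δ⁻¹ = γ^d` for every `d ≥ 1` forces `γ = 1`
(take `d` the order of `γ`). [cite: MochizukiFrdI2008, Rem. 3.1.2 p.58] -/
private theorem eq_one_of_conj_eq_pow {G : Type*} [Group G] [Finite G] (γ : G)
    (h : ∀ d : ℕ+, ∃ δ : G, δ * γ * δ⁻¹ = γ ^ (d : ℕ)) : γ = 1 := by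
  obtain ⟨δ, hδ⟩ := h ⟨orderOf γ, orderOf_pos γ⟩
  rw [PNat.mk_coe, pow_orderOf_eq_one, mul_inv_eq_one, mul_eq_left] at hδ
  exact hδ

/-- **Remark 3.1.2** (PROVED): for a residually finite group `G`, "any homomorphism of monoids `𝔽 → G`
factors through the natural surjection `𝔽 ↠ N_{≥1}`" (FrdI p. 58). [cite: MochizukiFrdI2008, Rem. 3.1.2 p.58] -/
theorem factors_degHom_of_isResiduallyFiniteGroup {G : Type*} [Group G] (hG : IsResiduallyFiniteGroup G)
    (f : StandardFrobenioid →* G) : ∃ g : ℕ+ →* G, f = g.comp StandardFrobenioid.degHom := by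
  -- the image `γ` of the generator `(1, 1)` is trivial
  have hγ : f StandardFrobenioid.gen = 1 := by
    by_contra hne
    obtain ⟨N, hN, hfi, hγN⟩ := hG _ hne
    haveI := hN
    haveI := hfi
    let π : G →* G ⧸ N := QuotientGroup.mk' N
    have key : ∀ d : ℕ+, π (f (StandardFrobenioid.degSection d)) * π (f StandardFrobenioid.gen) =
        π (f StandardFrobenioid.gen) ^ (d : ℕ) * π (f (StandardFrobenioid.degSection d)) := fun d => by
      rw [← map_mul, ← map_mul, StandardFrobenioid.degSection_mul_gen, map_mul, map_mul, map_pow, map_pow]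
    have hq : π (f StandardFrobenioid.gen) = 1 :=
      eq_one_of_conj_eq_pow _ fun d => ⟨π (f (StandardFrobenioid.degSection d)), by
        rw [mul_inv_eq_iff_eq_mul, key]⟩
    exact hγN ((QuotientGroup.eq_one_iff _).mp hq)
  refine ⟨f.comp StandardFrobenioid.degSection, MonoidHom.ext fun x => ?_⟩
  conv_lhs => rw [StandardFrobenioid.eq_gen_pow_mul_degSection x]
  rw [map_mul, map_pow, hγ, one_pow, one_mul]
  rfl

/-- "In particular, it follows that if `E` is a category such that for every `A ∈ Ob(E)`, the group
`Aut(E_A → E)` is residually finite, then `E` is Frobenius-slim" (FrdI Rem. 3.1.2 p. 58; PROVED).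
[cite: MochizukiFrdI2008, Rem. 3.1.2 p.58] -/
theorem isFrobeniusSlim_of_residuallyFinite {E : Type u} [Category.{v} E]
    (h : ∀ A : E, IsResiduallyFiniteGroup (Aut (Over.forget A))) : IsFrobeniusSlim E :=
  ⟨fun A f => factors_degHom_of_isResiduallyFiniteGroup (h A) f⟩

/-- **Remark 3.1.3** (typed): the checkable examples of the remark — "categories such as `Order(ℤ_{≥0})`,
`Order(N_{≥1})` or [the one-object categories determined by] `ℤ_{≥0}`, `N_{≥1}` are not of FSMFF-type",
while `Order(-)` of a finite subset of `ℤ_{≥0}` of cardinality `≥ 2` "is of FSMFF-, but not of FSM-type"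
(FrdI p. 58); recorded here for the one-object category of `N_{≥1}` and for `Order(ℤ_{≥0})`
(`DivOrder (Multiplicative ℕ)` of `Monoids.lean`), together with "a typical example of a 'base category'
is constituted by the subcategory of connected objects of a Galois category [which is easily verified to
be of FSM-, hence also of FSMFF-type]" (over Mathlib's `GaloisCategory`, with `C⁰` of `Categories.lean`).
The remark's "fundamental dichotomy" table (base category / Frobenius; "indifferent to order" /
"order-conscious"; groups / non-group-like monoids) is prose. [cite: MochizukiFrdI2008, Rem. 3.1.3 p.58] -/
def Remark313 : Prop :=
  ¬ IsOfFSMFFType (SingleObj ℕ+) ∧ ¬ IsOfFSMFFType (DivOrder (Multiplicative ℕ)) ∧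
    ∀ (G : Type u) [Category.{v} G] [GaloisCategory G], IsOfFSMType (ConnectedPart G)

end Remarks

/-! ### Proposition 3.2 (Perfections of Frobenioids) — typed over `PerfectionData` -/

section Prop32

variable {C : Type u} [Category.{v} C] {D : Type u'} [Category.{v'} D]
variable (S : PreFrobenioidData.{w} C D) (P : PerfectionData S)

/-- **Proposition 3.2 (i)** (typed): the natural 1-commutative square `C → C^pf` over `F_Φ → F_{Φ^pf}`;
in operations form: `C → C^pf` lies over `D` (the base functors 1-commute) and preserves Frobenius
degrees (FrdI p. 58–59). The third component of the square — zero divisors are carried along the natural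
map `Φ → Φ^pf` — is NOT a clause of this decl (the interface `PerfectionData` records no map `Φ → Φ^pf`;
referee C2-Fd/C3-Fa: v1–v4 docstrings wrongly suggested it was): it is `Prop32i_div` below, over that map as
a parameter, and is PROVED for THE perfection by abc-iut-L1-d9 (`PerfectionProofs`, `div_toPf`). Asserted
for Frobenioids of Frobenius-isotropic type. [cite: MochizukiFrdI2008, Prop. 3.2 (i) p.58] -/
def Prop32i : Prop :=
  Nonempty (P.toPf ⋙ P.ops.base ≅ S.base) ∧ ∀ ⦃A B : C⦄ (φ : A ⟶ B), P.ops.degFr (P.toPf.map φ) = S.degFr φ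

/-- **Proposition 3.2 (i)**, divisor component of the 1-commutative square (typed, v5): along the natural map
of monoids `ι : Φ → Φ^pf` ("the lower horizontal arrow is induced by the natural morphism of monoids
`Φ → Φ^pf`", p. 59) and a 1-commutation `η` of the base functors, `Div(φ) ↦ Div(C → C^pf (φ))`:
`Div^pf(toPf φ) = η_A^* ι(Div φ)`. SCHEMA (W2-8 (5)) over the data-only `P` and the parameter `ι` — faithful
for THE perfection (abc-iut-L1-d9 `PreFrobenioidData.perfection`, where `Φ^pf(X) = Perfection (Φ X)` and
`ι = Perfection.of`); not a closed citable fact. [cite: MochizukiFrdI2008, Prop. 3.2 (i) p.58] -/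
def Prop32i_div (ι : ∀ X : D, S.Mon X →* P.ops.Mon X) : Prop :=
  ∃ η : P.toPf ⋙ P.ops.base ≅ S.base,
    ∀ ⦃A B : C⦄ (φ : A ⟶ B), P.ops.div (P.toPf.map φ) = P.ops.pull (η.hom.app A) (ι (S.base.obj A) (S.div φ))

/-- **Proposition 3.2 (ii)** (typed, for the classes definable from the operations): an arrow of `C^pf`
in the image of `C` is of Frobenius type (resp. a pre-step, a base-isomorphism, an isometry, co-angular,
LB-invertible, of Frobenius degree `d`) if the arrow of `C` is so — the printed statement is the sharper
"iff a cofinal collection of the defining system is so" (FrdI p. 59). [cite: MochizukiFrdI2008, Prop. 3.2 (ii) p.59] -/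
def Prop32ii : Prop :=
  PreFrobenioidData.PreservesMor P.toPf S.IsFrobeniusType P.ops.IsFrobeniusType ∧
    PreFrobenioidData.PreservesMor P.toPf S.IsPreStep P.ops.IsPreStep ∧
    PreFrobenioidData.PreservesMor P.toPf S.IsBaseIso P.ops.IsBaseIso ∧
    PreFrobenioidData.PreservesMor P.toPf S.IsIsometry P.ops.IsIsometry ∧
    PreFrobenioidData.PreservesMor P.toPf S.IsCoAngular P.ops.IsCoAngular ∧
    PreFrobenioidData.PreservesMor P.toPf S.IsLBInvertible P.ops.IsLBInvertible ∧
    ∀ d, PreFrobenioidData.PreservesMor P.toPf (S.HasDegree d) (P.ops.HasDegree d)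

/-- **Proposition 3.2 (ii)**, the remaining printed classes (typed, v5; referee C2-Fe): an arrow of `C^pf` in
the image of `C` is a base-identity endomorphism, resp. a pull-back morphism, if the arrow of `C` is so
(FrdI p. 59). The printed class "isomorphism" is automatic in this direction for any functor
(`Functor.map_isIso`) and is not listed. [cite: MochizukiFrdI2008, Prop. 3.2 (ii) p.59] -/
def Prop32ii_rest : Prop :=
  (∀ ⦃A : C⦄ (φ : A ⟶ A), S.IsBaseIdentity φ → P.ops.IsBaseIdentity (P.toPf.map φ)) ∧
    PreFrobenioidData.PreservesMor P.toPf S.IsPullbackMorphism P.ops.IsPullbackMorphism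

/-- **Proposition 3.2 (iii)** (typed): `C^pf` is of perfect and isotropic type, and "there is a natural
equivalence of categories `C^pf ≃ (C^pf)^pf`" — the latter stated for a GIVEN perfection datum `PP` of `C^pf`
(its functor `C^pf → (C^pf)^pf` is an equivalence); `PerfectionData` being a data-only interface, the
statement is faithful when `P`, `PP` are THE perfections (never quantify universally over them — a junk
datum refutes any such `∀`, cf. the cell's RQ7 audit) (FrdI p. 59). [cite: MochizukiFrdI2008, Prop. 3.2 (iii) p.59] -/
def Prop32iii (PP : PerfectionData P.ops) : Prop :=
  P.ops.IsOfPerfectType ∧ P.ops.IsOfIsotropicType ∧ PP.toPf.IsEquivalence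

end Prop32

/-! ### Proposition 3.3 (Base-identity pre-steps and units) -/

section Prop33

variable {C : Type u} [Category.{v} C] {D : Type u'} [Category.{v'} D]
variable (S : PreFrobenioidData.{w} C D)

namespace PreFrobenioidData

/-- `End(C^pl-bk_A → C)^bs-iso` (FrdI Prop. 3.3 (i) p. 59): endomorphisms (natural transformations) of
the forgetful functor from the category of pull-back morphisms over `A` to `C` all of whose components
are base-isomorphisms; rendered as compatible families of base-isomorphic endomorphisms indexed by the
pull-back morphisms `B → A`. [cite: MochizukiFrdI2008, Prop. 3.3 (i) p.59] -/
structure EndPlbkBsIso (A : C) where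
  /-- the component at the pull-back morphism `φ : B → A`, an endomorphism of `B` -/
  app : ∀ ⦃B : C⦄ (φ : B ⟶ A), S.IsPullbackMorphism φ → End B
  /-- naturality with respect to morphisms `B' → B` over `A` between pull-back morphisms -/
  naturality : ∀ ⦃B B' : C⦄ (φ : B ⟶ A) (hφ : S.IsPullbackMorphism φ) (φ' : B' ⟶ A) (hφ' : S.IsPullbackMorphism φ')
    (g : B' ⟶ B), g ≫ φ = φ' → g ≫ (show B ⟶ B from app φ hφ) = (show B' ⟶ B' from app φ' hφ') ≫ g
  /-- every component is a base-isomorphism -/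
  isBaseIso : ∀ ⦃B : C⦄ (φ : B ⟶ A) (hφ : S.IsPullbackMorphism φ), S.IsBaseIso (show B ⟶ B from app φ hφ)

variable {S} {A : C}

/-- Two elements of `End(C^pl-bk_A → C)^bs-iso` with the same components are equal.
[cite: MochizukiFrdI2008, Prop. 3.3 (i) p.59] -/
theorem EndPlbkBsIso.ext' {α β : S.EndPlbkBsIso A}
    (h : ∀ ⦃B : C⦄ (φ : B ⟶ A) (hφ : S.IsPullbackMorphism φ), α.app φ hφ = β.app φ hφ) : α = β := by
  obtain ⟨a, _, _⟩ := α
  obtain ⟨b, _, _⟩ := β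
  have : a = b := by
    funext B φ hφ
    exact h φ hφ
  subst this
  rfl

/-- Extensionality for `End(C^pl-bk_A → C)^bs-iso` (the `@[ext]` form of `ext'`).
[cite: MochizukiFrdI2008, Prop. 3.3 (i) p.59] -/
@[ext] theorem EndPlbkBsIso.ext {α β : S.EndPlbkBsIso A}
    (h : ∀ ⦃B : C⦄ (φ : B ⟶ A) (hφ : S.IsPullbackMorphism φ), α.app φ hφ = β.app φ hφ) : α = β :=
  EndPlbkBsIso.ext' h

/-- **Two-out-of-three for pull-back morphisms** (PROVED, v5): if `φ : B → A` and `g ≫ φ : B' → A` are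
pull-back morphisms, so is `g : B' → B`. Hence the morphisms of `C^pl-bk_A = (C^pl-bk)_A` (Def. 1.3 (i)(c):
pull-back morphisms `g` over `A`) between pull-back morphisms `φ' = g ≫ φ`, `φ` are ALL the morphisms `g` over
`A` between them — the binder of `EndPlbkBsIso.naturality` is print's (referee C3-Fb / d1-F1 addendum).
[cite: MochizukiFrdI2008, Def. 1.2 (ii) p.21] -/
theorem IsPullbackMorphism.of_comp {A B B' : C} {φ : B ⟶ A} {g : B' ⟶ B}
    (hφ : S.IsPullbackMorphism φ) (hgφ : S.IsPullbackMorphism (g ≫ φ)) : S.IsPullbackMorphism g := by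
  intro X χ β hβ
  have hβ' : β ≫ S.base.map (g ≫ φ) = S.base.map (χ ≫ φ) := by
    rw [Functor.map_comp, ← Category.assoc, hβ, Functor.map_comp]
  obtain ⟨ψ, ⟨hψ₁, hψ₂⟩, huniq⟩ := hgφ (χ ≫ φ) β hβ'
  refine ⟨ψ, ⟨?_, hψ₂⟩, fun ψ' hψ' => huniq ψ' ⟨by rw [← Category.assoc, hψ'.1], hψ'.2⟩⟩
  obtain ⟨θ, -, huθ⟩ := hφ (χ ≫ φ) (S.base.map χ) (by rw [Functor.map_comp])
  rw [huθ (ψ ≫ g) ⟨by rw [Category.assoc, hψ₁], by rw [Functor.map_comp, hψ₂, hβ]⟩, huθ χ ⟨rfl, rfl⟩]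

/-- The monoid `End(C^pl-bk_A → C)^bs-iso`: componentwise composition of endomorphisms (the monoid
structure of `End B` of Mathlib, `f * g = g ≫ f`), identity components as unit (FrdI Prop. 3.3 (i) p. 59
"any homomorphism of monoids `𝔽 → End(C^pl-bk_A → C)^bs-iso`"). [cite: MochizukiFrdI2008, Prop. 3.3 (i) p.59] -/
instance EndPlbkBsIso.instMonoid : Monoid (S.EndPlbkBsIso A) where
  one :=
    { app := fun _ _ _ => 1
      naturality := fun B B' φ _ φ' _ g _ => by
        change g ≫ 𝟙 B = 𝟙 B' ≫ g
        rw [Category.comp_id, Category.id_comp]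
      isBaseIso := fun B φ _ => by
        change IsIso (S.base.map (𝟙 B))
        rw [CategoryTheory.Functor.map_id]
        infer_instance }
  mul α β :=
    { app := fun _ φ hφ => α.app φ hφ * β.app φ hφ
      naturality := fun B B' φ hφ φ' hφ' g hg => by
        have hα : g ≫ α.app φ hφ = α.app φ' hφ' ≫ g := α.naturality φ hφ φ' hφ' g hg
        have hβ : g ≫ β.app φ hφ = β.app φ' hφ' ≫ g := β.naturality φ hφ φ' hφ' g hg
        change g ≫ (β.app φ hφ ≫ α.app φ hφ) = (β.app φ' hφ' ≫ α.app φ' hφ') ≫ g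
        rw [← Category.assoc, hβ, Category.assoc, hα, Category.assoc]
      isBaseIso := fun B φ hφ => by
        have hα : IsIso (S.base.map (α.app φ hφ)) := α.isBaseIso φ hφ
        have hβ : IsIso (S.base.map (β.app φ hφ)) := β.isBaseIso φ hφ
        change IsIso (S.base.map (β.app φ hφ ≫ α.app φ hφ))
        rw [CategoryTheory.Functor.map_comp]
        infer_instance }
  mul_assoc α β γ := EndPlbkBsIso.ext' fun _ φ hφ => mul_assoc (α.app φ hφ) (β.app φ hφ) (γ.app φ hφ)
  one_mul α := EndPlbkBsIso.ext' fun _ φ hφ => one_mul (α.app φ hφ)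
  mul_one α := EndPlbkBsIso.ext' fun _ φ hφ => mul_one (α.app φ hφ)

/-- Components of a product. [cite: MochizukiFrdI2008, Prop. 3.3 (i) p.59] -/
@[simp] theorem EndPlbkBsIso.mul_app (α β : S.EndPlbkBsIso A) ⦃B : C⦄ (φ : B ⟶ A) (hφ : S.IsPullbackMorphism φ) :
    (α * β).app φ hφ = α.app φ hφ * β.app φ hφ := rfl

/-- Components of the unit. [cite: MochizukiFrdI2008, Prop. 3.3 (i) p.59] -/
@[simp] theorem EndPlbkBsIso.one_app ⦃B : C⦄ (φ : B ⟶ A) (hφ : S.IsPullbackMorphism φ) :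
    (1 : S.EndPlbkBsIso A).app φ hφ = 1 := rfl

variable (S)

end PreFrobenioidData

/-- **Proposition 3.3 (i)**, first half (typed): if `D` is Frobenius-slim, the image of the generator
`1 ∈ ℤ_{≥0} ⊆ 𝔽` (`StandardFrobenioid.gen`) under any homomorphism of monoids
`f : 𝔽 → End(C^pl-bk_A → C)^bs-iso` has all its components base-identity pre-steps ("lie in `O^▷(-)`")
(FrdI p. 59). v2: `f` is an honest `MonoidHom` for the componentwise monoid structure (v1, accepted as
p404845, quantified over a pair `(Γ, Δ)` subject only to `Δ_d Γ = Γ^d Δ_d` — more data than print, since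
`d ↦ Δ_d` was not required multiplicative; audit L6-t19 F4 / d1-F1). [cite: MochizukiFrdI2008, Prop. 3.3 (i) p.59] -/
def Prop33i_forward (A : C) : Prop :=
  IsFrobeniusSlim D →
    ∀ (f : StandardFrobenioid →* S.EndPlbkBsIso A) ⦃B : C⦄ (φ : B ⟶ A) (hφ : S.IsPullbackMorphism φ),
      (f StandardFrobenioid.gen).app φ hφ ∈ S.endSubmonoid B

/-- **Proposition 3.3 (i)**, converse half (typed): if `C` is of Frobenius-normalized type and `A` is
Frobenius-trivial, every base-identity pre-step endomorphism of `A` is the component at `id_A` of the image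
of `1 ∈ ℤ_{≥0}` under some homomorphism of monoids `𝔽 → End(C^pl-bk_A → C)^bs-iso` (FrdI p. 59; v2 with an
honest `MonoidHom`, cf. `Prop33i_forward`). [cite: MochizukiFrdI2008, Prop. 3.3 (i) p.59] -/
def Prop33i_converse (A : C) : Prop :=
  S.IsOfFrobeniusNormalizedType → S.IsFrobeniusTrivial A → ∀ (hA : S.IsPullbackMorphism (𝟙 A)),
    ∀ α ∈ S.endSubmonoid A, ∃ f : StandardFrobenioid →* S.EndPlbkBsIso A,
      (f StandardFrobenioid.gen).app (𝟙 A) hA = α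

/-- **Proposition 3.3 (ii)** (typed): `α₁ ≈^{O^×} α₂` iff they map to the same morphism of `F_Φ`, i.e.
iff (a) `deg_Fr(α₁) = deg_Fr(α₂)`, (b) `Div(α₁) = Div(α₂)`, (c) `Base(α₁) = Base(α₂)` (FrdI p. 59).
[cite: MochizukiFrdI2008, Prop. 3.3 (ii) p.59] -/
def Prop33ii : Prop :=
  ∀ ⦃A B : S.Istr⦄ (α₁ α₂ : A ⟶ B), S.UnitEquiv α₁ α₂ ↔
    S.degFr α₁.hom = S.degFr α₂.hom ∧ S.div α₁.hom = S.div α₂.hom ∧ S.base.map α₁.hom = S.base.map α₂.hom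

/-- **Proposition 3.3 (iii)**, first half (PROVED for the quotient construction): the natural functor
`C^istr → C^un-tr` is full and essentially surjective (FrdI pp. 59–60). [cite: MochizukiFrdI2008, Prop. 3.3 (iii) p.59] -/
theorem toUntr_full_essSurj : S.toUntr.Full ∧ S.toUntr.EssSurj := ⟨inferInstance, inferInstance⟩

/-- **Proposition 3.3 (iii)**, second half (typed): `C^istr → C^un-tr` is an equivalence iff `C^istr` is of
unit-trivial type (FrdI p. 60). [cite: MochizukiFrdI2008, Prop. 3.3 (iii) p.60] -/
def Prop33iii : Prop := S.toUntr.IsEquivalence ↔ ∀ A : C, S.IsIsotropic A → S.IsUnitTrivial A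

/-- **Proposition 3.3 (iv)** (typed): `C^istr → F_Φ` factors through `C^un-tr` — unit-equivalent arrows have
the same `(Base, Div, deg_Fr)` — and the resulting `C^un-tr → F_Φ` is faithful: arrows of `C^un-tr` with the
same image coincide; it is essentially surjective iff `C^istr → D` is (same objects). The Frobenioid
structure it induces on `C^un-tr` (isotropic, unit-trivial type) and the list of reflected classes of arrows
are asserted in print for Frobenioids (FrdI p. 60). [cite: MochizukiFrdI2008, Prop. 3.3 (iv) p.60] -/
def Prop33iv : Prop :=
  (∀ ⦃A B : S.Istr⦄ (α₁ α₂ : A ⟶ B), S.UnitEquiv α₁ α₂ →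
      S.degFr α₁.hom = S.degFr α₂.hom ∧ S.div α₁.hom = S.div α₂.hom ∧
        S.base.map α₁.hom = S.base.map α₂.hom) ∧
    ∀ ⦃A B : S.Istr⦄ (α₁ α₂ : A ⟶ B),
      S.degFr α₁.hom = S.degFr α₂.hom → S.div α₁.hom = S.div α₂.hom →
        S.base.map α₁.hom = S.base.map α₂.hom → S.toUntr.map α₁ = S.toUntr.map α₂

/-- **Proposition 3.3 (v)** (typed): the functor `C → F_Φ` is an equivalence iff `C` is of `Aut`-ample,
unit-trivial and base-trivial type (FrdI p. 60). Since `Ob(F_Φ) = Ob(D)` and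
`Hom_{F_Φ}(A, B) = {(Base, Div, deg_Fr)}` (Def. 1.1 (iii)), "equivalence" unfolds to: faithful = an arrow
is determined by its three invariants; full = every triple `(f : Base A → Base B, Z ∈ Φ(Base A), n)` is
realised; essentially surjective = every object of `D` is isomorphic to some `Base A`.
[cite: MochizukiFrdI2008, Prop. 3.3 (v) p.60] -/
def Prop33v : Prop :=
  ((∀ ⦃A B : C⦄ (φ ψ : A ⟶ B), S.base.map φ = S.base.map ψ → S.div φ = S.div ψ →
        S.degFr φ = S.degFr ψ → φ = ψ) ∧
      (∀ (A B : C) (f : S.base.obj A ⟶ S.base.obj B) (Z : S.Mon (S.base.obj A)) (n : ℕ+),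
        ∃ φ : A ⟶ B, S.base.map φ = f ∧ S.div φ = Z ∧ S.degFr φ = n) ∧
      ∀ X : D, ∃ A : C, Nonempty (S.base.obj A ≅ X)) ↔
    S.IsOfAutAmpleType ∧ S.IsOfUnitTrivialType ∧ S.IsOfBaseTrivialType

end Prop33

end Literature.AlgebraicGeometry.Frobenioids
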